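import Literature.MathematicalPhysics.QuantumFieldTheory.GaugeOSData
import Summits.QuantumFields.YangMills.Theorems.EquipartitionCriticalityCriticalContinuumLimitStubThetaCorrRPTorus
import Summits.QuantumFields.YangMills.Theorems.EquipartitionCriticalityRPProbeCriticalityOddLimit
import Summits.QuantumFields.YangMills.Theorems.FradkinShenkerFlowClusteringToYangMillsStubReconstructibleGeometry
import Literature.Probability.Moments.OscillationCovariance
import HarnessLib

/-!
# `CriticalContinuumLimit` — line `Sketch`, stub `stub_bentCumulantCS` (torus input (T-CS)),
# part 1/3: the torus layer

Support file for crux `stmt-QuantumFields-8762`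
(`Summit.QuantumFields.YangMills.Theses.EquipartitionCriticality.CriticalContinuumLimit`), stub
`stub_bentCumulantCS` (reflection-positivity Cauchy–Schwarz for the bent third cumulant) of line
`Sketch` (skeleton `Cruxes/CriticalContinuumLimit/Lines/Sketch.lean`). This part is the torus layer,
packaged in the registered sub-goal `stub_bentCumulantCS_torus`; part 2
(`EquipartitionCriticalityCriticalContinuumLimitBentCumulantRPCS.lean`) does the half-space
bookkeeping of the translated cylinder observables and proves the stub in expanded form; part 3
(`EquipartitionCriticalityCriticalContinuumLimitStubBentCumulantCS.lean`) files the line's object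
`bentCumulant` and the registered stub. No definitions here.

**Setting.** The odd torus `(ℤ/(2S+1)ℤ)⁴`, `S ≥ 1`, Wilson's state `μ = wilsonMeasure ρ β`
(`β ≥ 0`, `ρ` continuous), Wave 0's torus reflection `Θ_T = GaugeConfig.timeReflect` (`t ↦ 1 - t`;
closed positive half = links based in `1 ≤ t ≤ S` and spatial links at `t = S+1`, negative half =
its image under the link reflection `edgeReflect`), torus translations `T_v = torusConfigShift v`.

**Content.**
* *Abstract probability*: `|Cov(X, Y)| ≤ 4‖X‖∞‖Y‖∞` (with the tree's
  `abs_integral_le_of_forall_abs_le`), the cumulant identity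
  `E[XZY] − E[X]E[ZY] − E[Z]E[XY] − E[Y]E[XZ] + 2E[X]E[Z]E[Y] = Cov(XY, Z) − E[X]Cov(Y, Z) − E[Y]Cov(X, Z)`
  and the bookkeeping `|c₁ − E₁c₂ − E₂c₃| ≤ 6B²a` of three Cauchy–Schwarz bounds.
* *RP Cauchy–Schwarz across the bond plane* (`BentCumulantCS.abs_cov_le_of_neg_pos`): for a bounded
  measurable `F` on the negative half, `|F| ≤ B`, and `K` on the closed positive half,
  `0 ≤ Cov(K∘Θ_T, K)` and `|Cov(F, K)| ≤ 2B · Cov(K∘Θ_T, K)^{1/2}` — the tree's centred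
  Osterwalder–Seiler positivity with discriminant (`ThetaCorrRP.cov_rpcs`) applied to `F∘Θ_T` and
  `K`, together with `Cov(F, F∘Θ_T) ≤ (2B)²`.
* *Bridge to the `Θ`-paired correlator* (`BentCumulantCS.corr_theta_two_mul`): for bounded
  measurable `P` on `ℤ⁴` configurations and `Z_c = P ∘ lift ∘ T_{-(s+1)e₀}`,
  `Cov(Z_c∘Θ_T, Z_c) = latticeConnectedCorr ρ β (2S+1) (P ∘ Θ) P (2s)` (`Θ = gaugeTimeReflect`): the
  lift intertwines `Θ ∘ lift = lift ∘ T_{-2e₀} ∘ Θ_T` (tree `gaugeTimeReflect_torusLift`) and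
  `configShift v ∘ lift = lift ∘ T_{proj v}` (tree `configShift_torusLift`), `Θ_T T_{ce₀} = T_{-ce₀} Θ_T`,
  and `μ` is translation and `Θ_T` invariant (substitute `U ↦ T_{(1-s)e₀} U`).

References: K. Osterwalder, E. Seiler, Ann. Phys. 110 (1978) 440, §2; E. Seiler, LNP 159 (1982)
Ch. 2; J. Glimm, A. Jaffe, *Quantum Physics* (1987) §6.1 and §19.
-/

noncomputable section

open MeasureTheory Filter Topology ProbabilityTheory
open Literature.MathematicalPhysics.AQFT Literature.MathematicalPhysics.QuantumLattice
open Literature.MathematicalPhysics.QuantumFieldTheory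

namespace Summit.QuantumFields.YangMills.Theorems.CriticalContinuumLimit

namespace BentCumulantCS

/-! ### Abstract probability: bounded observables, the cumulant identity -/

section Abstract

variable {Ω : Type*} [MeasurableSpace Ω] {μ : Measure Ω}

/-- `|Cov(X, Y)| ≤ (2 B_X)(2 B_Y)` for bounded `X`, `Y` on a probability space. [folklore] -/
theorem abs_covariance_le [IsProbabilityMeasure μ] {X Y : Ω → ℝ} {BX BY : ℝ}
    (hX : ∀ ω, |X ω| ≤ BX) (hY : ∀ ω, |Y ω| ≤ BY) :
    |cov[X, Y; μ]| ≤ (2 * BX) * (2 * BY) := by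
  rw [covariance]
  refine Literature.Probability.Moments.abs_integral_le_of_forall_abs_le fun ω => ?_
  rw [abs_mul]
  have h1 : |X ω - ∫ x, X x ∂μ| ≤ 2 * BX :=
    (abs_sub _ _).trans (by
      linarith [hX ω, Literature.Probability.Moments.abs_integral_le_of_forall_abs_le (μ := μ) hX])
  have h2 : |Y ω - ∫ x, Y x ∂μ| ≤ 2 * BY :=
    (abs_sub _ _).trans (by
      linarith [hY ω, Literature.Probability.Moments.abs_integral_le_of_forall_abs_le (μ := μ) hY])
  exact mul_le_mul h1 h2 (abs_nonneg _) ((abs_nonneg _).trans h1)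

/-- Bounded measurable functions are square integrable on a finite measure space. [folklore] -/
theorem memLp_two_of_bound [IsFiniteMeasure μ] {f : Ω → ℝ} (hf : Measurable f) {C : ℝ}
    (hC : ∀ ω, |f ω| ≤ C) : MemLp f 2 μ :=
  MemLp.of_bound hf.aestronglyMeasurable C
    (ae_of_all _ fun ω => by rw [Real.norm_eq_abs]; exact hC ω)

/-- **The cumulant identity**: the third cumulant of `(X, Z, Y)` is
`Cov(XY, Z) − E[X] Cov(Y, Z) − E[Y] Cov(X, Z)`. [folklore] -/
theorem cumulant_eq_cov [IsProbabilityMeasure μ] {X Y Z : Ω → ℝ} (hX : Measurable X)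
    (hY : Measurable Y) (hZ : Measurable Z) {BX BY BZ : ℝ} (hbX : ∀ ω, |X ω| ≤ BX)
    (hbY : ∀ ω, |Y ω| ≤ BY) (hbZ : ∀ ω, |Z ω| ≤ BZ) :
    (∫ ω, X ω * Z ω * Y ω ∂μ) - (∫ ω, X ω ∂μ) * (∫ ω, Z ω * Y ω ∂μ)
        - (∫ ω, Z ω ∂μ) * (∫ ω, X ω * Y ω ∂μ) - (∫ ω, Y ω ∂μ) * (∫ ω, X ω * Z ω ∂μ)
        + 2 * ((∫ ω, X ω ∂μ) * (∫ ω, Z ω ∂μ) * (∫ ω, Y ω ∂μ)) =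
      cov[fun ω => X ω * Y ω, Z; μ] - (∫ ω, X ω ∂μ) * cov[Y, Z; μ]
        - (∫ ω, Y ω ∂μ) * cov[X, Z; μ] := by
  have mX : MemLp X 2 μ := memLp_two_of_bound hX hbX
  have mY : MemLp Y 2 μ := memLp_two_of_bound hY hbY
  have mZ : MemLp Z 2 μ := memLp_two_of_bound hZ hbZ
  have mXY : MemLp (fun ω => X ω * Y ω) 2 μ :=
    memLp_two_of_bound (hX.mul hY) (C := BX * BY) fun ω => by
      rw [abs_mul]
      exact mul_le_mul (hbX ω) (hbY ω) (abs_nonneg _) ((abs_nonneg _).trans (hbX ω))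
  rw [covariance_eq_sub mXY mZ, covariance_eq_sub mY mZ, covariance_eq_sub mX mZ]
  simp only [Pi.mul_apply]
  have e1 : ∫ ω, X ω * Z ω * Y ω ∂μ = ∫ ω, X ω * Y ω * Z ω ∂μ :=
    integral_congr_ae (Eventually.of_forall fun ω => mul_right_comm _ _ _)
  have e2 : ∫ ω, Z ω * Y ω ∂μ = ∫ ω, Y ω * Z ω ∂μ :=
    integral_congr_ae (Eventually.of_forall fun ω => mul_comm _ _)
  rw [e1, e2]
  ring

/-- Bookkeeping of the three Cauchy–Schwarz bounds:
`|c₁ − E₁ c₂ − E₂ c₃| ≤ 6 B² a`. [folklore] -/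
theorem abs_cumulant_le {E1 E2 c1 c2 c3 B a : ℝ} (hB : 0 ≤ B) (hE1 : |E1| ≤ B) (hE2 : |E2| ≤ B)
    (h1 : |c1| ≤ 2 * (B * B) * a) (h2 : |c2| ≤ 2 * B * a) (h3 : |c3| ≤ 2 * B * a) :
    |c1 - E1 * c2 - E2 * c3| ≤ 6 * B ^ 2 * a := by
  have i2 : |E1 * c2| ≤ B * (2 * B * a) := by
    rw [abs_mul]; exact mul_le_mul hE1 h2 (abs_nonneg _) hB
  have i3 : |E2 * c3| ≤ B * (2 * B * a) := by
    rw [abs_mul]; exact mul_le_mul hE2 h3 (abs_nonneg _) hB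
  calc |c1 - E1 * c2 - E2 * c3| ≤ |c1| + |E1 * c2| + |E2 * c3| := by
        have := abs_sub (c1 - E1 * c2) (E2 * c3)
        have := abs_sub c1 (E1 * c2)
        linarith
    _ ≤ 2 * (B * B) * a + B * (2 * B * a) + B * (2 * B * a) := by linarith
    _ = 6 * B ^ 2 * a := by ring

end Abstract

/-! ### The torus layer: RP Cauchy–Schwarz across the bond plane, and the bridge to `a_S(2s)` -/

section Torus

variable {G : Type} [Group G] [TopologicalSpace G] [IsTopologicalGroup G] [CompactSpace G]
  [MeasurableSpace G] [BorelSpace G] {N : ℕ} (ρ : G →* Matrix (Fin N) (Fin N) ℂ) {S : ℕ} {β : ℝ}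

/-- **Reflection-positivity Cauchy–Schwarz across the bond plane** of the odd torus
`(ℤ/(2S+1)ℤ)⁴`, `S ≥ 1`, `β ≥ 0`, `ρ` continuous: for a bounded measurable `F` living on the
negative half (the `Θ_T`-image of the closed positive half), `|F| ≤ B`, and a bounded measurable
`K` on the closed positive half, `0 ≤ Cov(K ∘ Θ_T, K)` and
`|Cov(F, K)| ≤ 2 B · Cov(K ∘ Θ_T, K)^{1/2}` (from `Cov(F, K)² ≤ Cov(F, F∘Θ_T) Cov(K∘Θ_T, K)`,
tree `ThetaCorrRP.cov_rpcs`, and `Cov(F, F∘Θ_T) ≤ (2B)²`). [folklore] -/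
theorem abs_cov_le_of_neg_pos (hρ : Continuous ρ) (hβ : 0 ≤ β) (hS : 1 ≤ S)
    {F K : GaugeConfig 4 (2 * S + 1) G → ℝ} (hF : Measurable F) (hK : Measurable K) {B : ℝ}
    (hB : ∀ U, |F U| ≤ B) (hKb : ∃ C : ℝ, ∀ U, |K U| ≤ C)
    (hFD : DependsOn F {e : Edge 4 (2 * S + 1) | WilsonRP.edgeReflect e ∈
      {e : Edge 4 (2 * S + 1) | WilsonOddRP.IsOPosEdge e ∨ WilsonOddRP.IsOSharedEdge e}})
    (hKD : DependsOn K
      {e : Edge 4 (2 * S + 1) | WilsonOddRP.IsOPosEdge e ∨ WilsonOddRP.IsOSharedEdge e}) :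
    0 ≤ cov[fun U => K (GaugeConfig.timeReflect U), K;
        wilsonMeasure (d := 4) (L := 2 * S + 1) ρ β] ∧
      |cov[F, K; wilsonMeasure (d := 4) (L := 2 * S + 1) ρ β]| ≤
        2 * B * Real.sqrt (cov[fun U => K (GaugeConfig.timeReflect U), K;
          wilsonMeasure (d := 4) (L := 2 * S + 1) ρ β]) := by
  haveI := isProbabilityMeasure_wilsonMeasure (d := 4) (L := 2 * S + 1) ρ hρ β
  have hB0 : 0 ≤ B := (abs_nonneg _).trans (hB fun _ => 1)
  have hFD' : DependsOn (fun U => F (GaugeConfig.timeReflect U))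
      {e : Edge 4 (2 * S + 1) | WilsonOddRP.IsOPosEdge e ∨ WilsonOddRP.IsOSharedEdge e} :=
    ThetaCorrRP.dependsOn_comp_timeReflect hFD fun e he => he
  have h := ThetaCorrRP.cov_rpcs ρ hρ hβ hS (F := fun U => F (GaugeConfig.timeReflect U)) (K := K)
    (hF.comp WilsonRP.measurable_timeReflect) hK ⟨B, fun U => hB _⟩ hKb hFD' hKD
  simp only [FiniteSusceptibilityWeakCoupling.RPCauchySchwarz.timeReflect_timeReflect] at h
  obtain ⟨h1, h2⟩ := h
  have hK0 : 0 ≤ cov[fun U => K (GaugeConfig.timeReflect U), K;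
      wilsonMeasure (d := 4) (L := 2 * S + 1) ρ β] :=
    (ThetaCorrRP.cov_rpcs ρ hρ hβ hS hK hK hKb hKb hKD hKD).1
  refine ⟨hK0, ?_⟩
  have hFF : cov[F, fun U => F (GaugeConfig.timeReflect U);
      wilsonMeasure (d := 4) (L := 2 * S + 1) ρ β] ≤ (2 * B) ^ 2 := by
    rw [sq]
    exact (le_abs_self _).trans (abs_covariance_le hB fun U => hB (GaugeConfig.timeReflect U))
  calc |cov[F, K; wilsonMeasure (d := 4) (L := 2 * S + 1) ρ β]|
      ≤ Real.sqrt (cov[F, fun U => F (GaugeConfig.timeReflect U);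
            wilsonMeasure (d := 4) (L := 2 * S + 1) ρ β] *
          cov[fun U => K (GaugeConfig.timeReflect U), K;
            wilsonMeasure (d := 4) (L := 2 * S + 1) ρ β]) := Real.abs_le_sqrt h2
    _ = Real.sqrt (cov[F, fun U => F (GaugeConfig.timeReflect U);
            wilsonMeasure (d := 4) (L := 2 * S + 1) ρ β]) *
          Real.sqrt (cov[fun U => K (GaugeConfig.timeReflect U), K;
            wilsonMeasure (d := 4) (L := 2 * S + 1) ρ β]) := Real.sqrt_mul h1 _
    _ ≤ 2 * B * Real.sqrt (cov[fun U => K (GaugeConfig.timeReflect U), K;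
            wilsonMeasure (d := 4) (L := 2 * S + 1) ρ β]) :=
        mul_le_mul_of_nonneg_right
          ((Real.sqrt_le_sqrt hFF).trans_eq (Real.sqrt_sq (by positivity))) (Real.sqrt_nonneg _)

/-- Torus Wilson expectations are translation invariant (integral form of
`wilsonExpectation_comp_torusConfigShift`). [folklore] -/
theorem integral_comp_torusConfigShift {L : ℕ} [NeZero L] (β : ℝ) (v : Site 4 L)
    (f : GaugeConfig 4 L G → ℝ) :
    ∫ U, f (torusConfigShift v U) ∂(wilsonMeasure (d := 4) (L := L) ρ β) =
      ∫ U, f U ∂(wilsonMeasure (d := 4) (L := L) ρ β) := by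
  have h := wilsonExpectation_comp_torusConfigShift (d := 4) ρ β v f
  simpa only [wilsonExpectation, Function.comp_apply] using h

/-- Torus Wilson expectations are `Θ_T`-invariant (integral form of
`wilsonExpectation_comp_timeReflect`). [folklore] -/
theorem integral_comp_timeReflect {L : ℕ} [NeZero L] (hρ : Continuous ρ) (β : ℝ)
    (f : GaugeConfig 4 L G → ℝ) :
    ∫ U, f (GaugeConfig.timeReflect U) ∂(wilsonMeasure (d := 4) (L := L) ρ β) =
      ∫ U, f U ∂(wilsonMeasure (d := 4) (L := L) ρ β) := by
  have h := ClusteringToYangMills.Reconstructible.wilsonExpectation_comp_timeReflect ρ hρ β f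
  simpa only [wilsonExpectation, Function.comp_apply] using h

/-- Covariances under the torus Wilson state are translation invariant. [folklore] -/
theorem cov_comp_torusConfigShift {L : ℕ} [NeZero L] (β : ℝ) (v : Site 4 L)
    (F K : GaugeConfig 4 L G → ℝ) :
    cov[fun U => F (torusConfigShift v U), fun U => K (torusConfigShift v U);
        wilsonMeasure (d := 4) (L := L) ρ β] =
      cov[F, K; wilsonMeasure (d := 4) (L := L) ρ β] := by
  conv_rhs => rw [← wilsonMeasure_map_torusConfigShift ρ β v]
  rw [covariance_map_equiv]
  rfl

/-- **Bridge to the `Θ`-paired correlator.** For a bounded measurable `P` on `ℤ⁴` configurations,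
with `Z_c = P ∘ lift ∘ T_{-(s+1)e₀}` on the torus of side `2S+1`,
`Cov(Z_c ∘ Θ_T, Z_c) = latticeConnectedCorr ρ β (2S+1) (P ∘ Θ) P (2s)`: the lift intertwines
`Θ ∘ lift = lift ∘ T_{-2e₀} ∘ Θ_T` and `configShift (-2s e₀) ∘ lift = lift ∘ T_{-2s e₀}`, the torus
reflection satisfies `Θ_T T_{ce₀} = T_{-ce₀} Θ_T`, and the torus state is translation and `Θ_T`
invariant (substitute `U ↦ T_{(1-s)e₀} U`). [folklore] -/
theorem corr_theta_two_mul (hρ : Continuous ρ) (β : ℝ) (S s : ℕ) {P : LGConfig 4 G → ℝ}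
    (hP : Measurable P) (hPb : ∃ C : ℝ, ∀ V, |P V| ≤ C) :
    latticeConnectedCorr ρ β (2 * S + 1) (P ∘ gaugeTimeReflect) P (2 * s) =
      cov[fun U => P (torusLift (2 * S + 1) (torusConfigShift
              (Pi.single 0 (-((s + 1 : ℕ) : ZMod (2 * S + 1)))) (GaugeConfig.timeReflect U))),
          fun U => P (torusLift (2 * S + 1) (torusConfigShift
              (Pi.single 0 (-((s + 1 : ℕ) : ZMod (2 * S + 1)))) U));
          wilsonMeasure (d := 4) (L := 2 * S + 1) ρ β] := by
  haveI := isProbabilityMeasure_wilsonMeasure (d := 4) (L := 2 * S + 1) ρ hρ β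
  obtain ⟨C, hC⟩ := hPb
  have hm : ∀ v : Site 4 (2 * S + 1), Measurable fun U : GaugeConfig 4 (2 * S + 1) G =>
      P (torusLift (2 * S + 1) (torusConfigShift v U)) := fun v =>
    hP.comp ((measurable_torusLift _).comp (torusConfigShift v).measurable)
  have m1 : MemLp (fun U : GaugeConfig 4 (2 * S + 1) G => P (torusLift (2 * S + 1)
      (torusConfigShift (Pi.single 0 (-((s + 1 : ℕ) : ZMod (2 * S + 1))))
        (GaugeConfig.timeReflect U)))) 2 (wilsonMeasure (d := 4) (L := 2 * S + 1) ρ β) :=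
    memLp_two_of_bound ((hm _).comp WilsonRP.measurable_timeReflect) fun U => hC _
  have m2 : MemLp (fun U : GaugeConfig 4 (2 * S + 1) G => P (torusLift (2 * S + 1)
      (torusConfigShift (Pi.single 0 (-((s + 1 : ℕ) : ZMod (2 * S + 1)))) U))) 2
        (wilsonMeasure (d := 4) (L := 2 * S + 1) ρ β) :=
    memLp_two_of_bound (hm _) fun U => hC _
  -- means
  have mean1 : ∫ U, P (torusLift (2 * S + 1) (torusConfigShift (Pi.single 0 (-2))
      (GaugeConfig.timeReflect U))) ∂(wilsonMeasure (d := 4) (L := 2 * S + 1) ρ β) =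
      ∫ U, P (torusLift (2 * S + 1) U) ∂(wilsonMeasure (d := 4) (L := 2 * S + 1) ρ β) := by
    rw [integral_comp_timeReflect ρ hρ β (fun U => P (torusLift (2 * S + 1)
      (torusConfigShift (Pi.single 0 (-2)) U)))]
    exact integral_comp_torusConfigShift ρ β _ (fun U => P (torusLift (2 * S + 1) U))
  have mean2 : ∫ U, P (torusLift (2 * S + 1) (torusConfigShift
      (Pi.single 0 (-((s + 1 : ℕ) : ZMod (2 * S + 1)))) (GaugeConfig.timeReflect U)))
        ∂(wilsonMeasure (d := 4) (L := 2 * S + 1) ρ β) =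
      ∫ U, P (torusLift (2 * S + 1) U) ∂(wilsonMeasure (d := 4) (L := 2 * S + 1) ρ β) := by
    rw [integral_comp_timeReflect ρ hρ β (fun U => P (torusLift (2 * S + 1)
      (torusConfigShift (Pi.single 0 (-((s + 1 : ℕ) : ZMod (2 * S + 1)))) U)))]
    exact integral_comp_torusConfigShift ρ β _ (fun U => P (torusLift (2 * S + 1) U))
  have mean3 : ∫ U, P (torusLift (2 * S + 1) (torusConfigShift
      (Pi.single 0 (-((s + 1 : ℕ) : ZMod (2 * S + 1)))) U))
        ∂(wilsonMeasure (d := 4) (L := 2 * S + 1) ρ β) =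
      ∫ U, P (torusLift (2 * S + 1) U) ∂(wilsonMeasure (d := 4) (L := 2 * S + 1) ρ β) :=
    integral_comp_torusConfigShift ρ β _ (fun U => P (torusLift (2 * S + 1) U))
  -- the product term: substitute `U ↦ T_{(1-s)e₀} U`
  have key : ∫ U, P (torusLift (2 * S + 1) (torusConfigShift
        (Pi.single 0 (-((s + 1 : ℕ) : ZMod (2 * S + 1)))) (GaugeConfig.timeReflect U))) *
      P (torusLift (2 * S + 1) (torusConfigShift
        (Pi.single 0 (-((s + 1 : ℕ) : ZMod (2 * S + 1)))) U))
        ∂(wilsonMeasure (d := 4) (L := 2 * S + 1) ρ β) =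
      ∫ U, P (torusLift (2 * S + 1) (torusConfigShift (Pi.single 0 (-2))
        (GaugeConfig.timeReflect U))) *
      P (torusLift (2 * S + 1) (torusConfigShift
        (Pi.single 0 (-((2 * s : ℕ) : ZMod (2 * S + 1)))) U))
        ∂(wilsonMeasure (d := 4) (L := 2 * S + 1) ρ β) := by
    rw [← integral_comp_torusConfigShift ρ β (Pi.single 0 (1 - (s : ZMod (2 * S + 1))))
      (fun U => P (torusLift (2 * S + 1) (torusConfigShift
        (Pi.single 0 (-((s + 1 : ℕ) : ZMod (2 * S + 1)))) (GaugeConfig.timeReflect U))) *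
      P (torusLift (2 * S + 1) (torusConfigShift
        (Pi.single 0 (-((s + 1 : ℕ) : ZMod (2 * S + 1)))) U)))]
    refine integral_congr_ae (Eventually.of_forall fun U => ?_)
    have e1 : (-((s + 1 : ℕ) : ZMod (2 * S + 1)) + -(1 - (s : ZMod (2 * S + 1)))) = -2 := by
      push_cast; ring
    have e2 : (-((s + 1 : ℕ) : ZMod (2 * S + 1)) + (1 - (s : ZMod (2 * S + 1)))) =
        -((2 * s : ℕ) : ZMod (2 * S + 1)) := by
      push_cast; ring
    simp only [ClusteringToYangMills.Reconstructible.timeReflect_torusConfigShift_single,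
      ClusteringToYangMills.Reconstructible.torusConfigShift_torusConfigShift, ← Pi.single_add,
      e1, e2]
  rw [covariance_eq_sub m1 m2]
  simp only [Pi.mul_apply, latticeConnectedCorr, Function.comp_apply,
    ClusteringToYangMills.Reconstructible.gaugeTimeReflect_torusLift,
    EquipartitionCriticality.RPProbe.configShift_torusLift,
    EquipartitionCriticality.RPProbe.torusProj_neg,
    EquipartitionCriticality.RPProbe.torusProj_single_zero]
  simp only [← Pi.single_neg]
  rw [key, mean1, mean2, mean3]

end Torus

end BentCumulantCS

/-! ### The registered sub-goal -/

/-- **Registered sub-goal `stub_bentCumulantCS_torus` of stub `stub_bentCumulantCS`** (part 1/3: the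
torus layer). On `(ℤ/(2S+1)ℤ)⁴`, `S ≥ 1`, at `β ≥ 0`, for continuous `ρ`: (i) for a bounded measurable
`F` on the negative half (`|F| ≤ B`) and a bounded measurable `K` on the closed positive half of
Wave 0's reflection `Θ_T`, `0 ≤ Cov(K∘Θ_T, K)` and `|Cov(F, K)| ≤ 2B · Cov(K∘Θ_T, K)^{1/2}`
(Osterwalder–Seiler positivity of the odd torus in Cauchy–Schwarz form); (ii) for a bounded
measurable `P` on `ℤ⁴` configurations, the `Θ`-paired torus correlator at separation `2s` is the
reflected covariance of `P ∘ lift ∘ T_{-(s+1)e₀}`. [folklore] -/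
theorem stub_bentCumulantCS_torus (G : Type) [Group G] [TopologicalSpace G] [IsTopologicalGroup G]
    [CompactSpace G] [MeasurableSpace G] [BorelSpace G] (N : ℕ) (ρ : G →* Matrix (Fin N) (Fin N) ℂ)
    (hρ : Continuous ρ) (β : ℝ) (hβ : 0 ≤ β) (S : ℕ) (hS : 1 ≤ S) :
    (∀ (F K : GaugeConfig 4 (2 * S + 1) G → ℝ) (B : ℝ), Measurable F → Measurable K →
      (∀ U, |F U| ≤ B) → (∃ C : ℝ, ∀ U, |K U| ≤ C) →
      DependsOn F {e : Edge 4 (2 * S + 1) | WilsonRP.edgeReflect e ∈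
        {e : Edge 4 (2 * S + 1) | WilsonOddRP.IsOPosEdge e ∨ WilsonOddRP.IsOSharedEdge e}} →
      DependsOn K {e : Edge 4 (2 * S + 1) | WilsonOddRP.IsOPosEdge e ∨ WilsonOddRP.IsOSharedEdge e} →
      0 ≤ ProbabilityTheory.covariance (fun U => K (GaugeConfig.timeReflect U)) K
          (wilsonMeasure (d := 4) (L := 2 * S + 1) ρ β) ∧
        |ProbabilityTheory.covariance F K (wilsonMeasure (d := 4) (L := 2 * S + 1) ρ β)| ≤
          2 * B * Real.sqrt (ProbabilityTheory.covariance (fun U => K (GaugeConfig.timeReflect U)) K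
            (wilsonMeasure (d := 4) (L := 2 * S + 1) ρ β))) ∧
    (∀ (s : ℕ) (P : LGConfig 4 G → ℝ), Measurable P → (∃ C : ℝ, ∀ V, |P V| ≤ C) →
      latticeConnectedCorr ρ β (2 * S + 1) (P ∘ gaugeTimeReflect) P (2 * s) =
        ProbabilityTheory.covariance
          (fun U => P (torusLift (2 * S + 1) (torusConfigShift
            (Pi.single 0 (-((s + 1 : ℕ) : ZMod (2 * S + 1)))) (GaugeConfig.timeReflect U))))
          (fun U => P (torusLift (2 * S + 1) (torusConfigShift
            (Pi.single 0 (-((s + 1 : ℕ) : ZMod (2 * S + 1)))) U)))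
          (wilsonMeasure (d := 4) (L := 2 * S + 1) ρ β)) :=
  ⟨fun _ _ _ hF hK hB hKb hFD hKD =>
      BentCumulantCS.abs_cov_le_of_neg_pos ρ hρ hβ hS hF hK hB hKb hFD hKD,
    fun s _ hP hPb => BentCumulantCS.corr_theta_two_mul ρ hρ β S s hP hPb⟩

end Summit.QuantumFields.YangMills.Theorems.CriticalContinuumLimit

end
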